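import Mathlib.Probability.Distributions.Gaussian.Multivariate
import Mathlib.MeasureTheory.Constructions.HaarToSphere
import Mathlib.MeasureTheory.Function.L2Space
import Mathlib.Analysis.Distribution.TemperateGrowth
import Mathlib.Analysis.InnerProductSpace.PiL2
import Mathlib.Analysis.InnerProductSpace.LinearPMap
import Mathlib.Topology.Algebra.Module.LinearPMap
import Literature.Analysis.UnboundedOperators.SymmetricPMap
import Literature.MathematicalPhysics.KineticTheory.Hilbert6Wave0
import HarnessLib

-- provenance: harness21/H21/H21/Prelude/UnbddOp/LinearizedBoltzmann.lean @ cfecf1d (interim HEAD d8f2665); M5 mechanical rewrite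
/-!
# The linearised Boltzmann collision operator around the Maxwellian

Trunk: UnbddOp (prelude item C8 `LinearizedBoltzmann`; notion `linearized_boltzmann_spectral`
of family `hilbert6`).

Let `E` be a finite-dimensional real inner product space (velocity space, `d = finrank ℝ E`) and
let `M(v) = (2π)^{-d/2} e^{-|v|²/2}` be the centred, normalised Maxwellian; the measure `M(v) dv`
is Mathlib's `ProbabilityTheory.stdGaussian E`, so that `L²(M dv) = Lp ℝ 2 (stdGaussian E)`.
Writing a perturbation of `M` as `F = M (1 + g)`, the Boltzmann collision operator `Q` of
`Literature.Statements.Hilbert6.Wave0` linearises to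
`L g = M⁻¹ (Q(M, M g) + Q(M g, M))
     = ∫_E ∫_{S^{d-1}} B(v, v_*, ω) (g(v') + g(v_*') - g(v) - g(v_*)) M(v_*) dω dv_*`,
(`Hilbert6.collide ω (v, v_*) = (v', v_*')`), a symmetric **non-positive** operator on `L²(M dv)`
whose kernel is the space of collision invariants `span {1, v₁, …, v_d, |v|²}` and which, for hard
spheres, has a spectral gap. This file provides, at function level:

* `Literature.temperateGrowth E`: the submodule of smooth polynomially bounded functions `E → ℝ`
  (Mathlib's `Function.HasTemperateGrowth`), used as the common domain of all identities;
* `Literature.linearizedCollisionOp B g`, `Literature.hardSphereLinearizedOp g`: the linearised collision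
  operator for a general kernel `B` and for Wave0's `Hilbert6.hardSphereKernel`;
* `Literature.maxwellianInner g h = ∫ g h dM`: the `L²(M)` pairing at function level;
* `Literature.collisionInvariants E = span ({1, |·|²} ∪ {⟪·, e⟫ | e})`;
* `Literature.dirichletFormInv L A = sup_g (2⟪A, g⟫_M + ⟪g, L g⟫_M) = ⟪A, (-L)⁻¹ A⟩_M`: the variational
  (choice-free) expression for the quadratic form of the pseudo-inverse of `-L`;
* the Burnett functions `Literature.burnettA b i j` (traceless `v ⊗ v`), `Literature.burnettB b i`
  (`½ vᵢ (|v|² - (d+2))`) and the Dirichlet sums `Literature.Analysis.UnboundedOperators.viscosityDirichletSum`,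
  `Literature.Analysis.UnboundedOperators.conductivityDirichletSum` entering the Chapman–Enskog viscosity and heat conductivity
  (the normalising constants are *not* in this file; they belong to the statement file
  `H21/Statements/Hilbert6/LinearizedBoltzmann.lean` together with their citation);
* the classical theorems (proofs `sorry`): symmetry, non-positivity, kernel = collision
  invariants, the Baranger–Mouhot spectral gap, and the existence of a self-adjoint realisation on
  `Lp ℝ 2 (stdGaussian E)` with core the temperate-growth classes.

Sources: Cercignani–Illner–Pulvirenti, *The Mathematical Theory of Dilute Gases* (1994) §7.1–7.2;
Ellis–Pinsky, *The first and second fluid approximations to the linearized Boltzmann equation*,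
J. Math. Pures Appl. 54 (1975) 125–156; Baranger–Mouhot, *Explicit spectral gap estimates for the
linearized Boltzmann and Landau operators with hard potentials*, Rev. Mat. Iberoam. 21 (2005),
Thm 1.1; Bardos–Golse–Levermore, CPAM 46 (1993) §2 (Burnett functions).

## Mathlib

Used without redefinition: `Function.HasTemperateGrowth` (+ `.add`, `.smul`, `.const`, `.zero`,
`hasTemperateGrowth_inner_left`, `hasTemperateGrowth_norm_sq`), `ProbabilityTheory.stdGaussian`
(+ `isProbabilityMeasure_stdGaussian`), `MeasureTheory.Lp ℝ 2 μ` with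
`MeasureTheory.L2.innerProductSpace`, `LinearPMap`, `LinearPMap.HasCore`, `LinearPMap.instStar`
(so `IsSelfAdjoint A` for `A : Lp →ₗ.[ℝ] Lp`), `OrthonormalBasis.repr`, `Measure.toSphere` (via
Wave0's `Hilbert6.sphereMeasure`). From H21: `Hilbert6.collide`, `Hilbert6.hardSphereKernel`,
`Hilbert6.sphereMeasure`, `Hilbert6.IsCollisionInvariant`, `LinearPMap.IsPositive` (C1).
Mathlib has no submodule of temperate-growth functions (searched `Submodule` in
`Analysis/Distribution/TemperateGrowth.lean`) and nothing on the (linearised) Boltzmann equation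
(searched `Boltzmann`, `linearized`, `collision`).

## Design choices

* Namespace `Literature` (not `Literature.Hilbert6`) to avoid clashes with the statement file S-B.
* This *prelude* file imports the *statement* file `Literature.Statements.Hilbert6.Wave0` for the
  kinematics (`collide`, `hardSphereKernel`, `sphereMeasure`, `IsCollisionInvariant`); this
  layering exception is review-sanctioned (outline UnbddOp §4.6). **Request to the supervisor:**
  move those Wave0 declarations to `H21/Prelude/Kinetic/Collision.lean` (names unchanged) when the
  kinetic trunk lands; this file then swaps one import line.
* Everything is at function level `E → ℝ`; integrals are Bochner integrals (junk value `0` when not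
  integrable). All identities are stated on `temperateGrowth E`, on which every integral against
  the Gaussian converges. The genuine operator domain `{g | (1 + |v|) g ∈ L²(M)}` enters only
  through `exists_isSelfAdjoint_hasCore` (`LinearPMap.HasCore`).
* Sign convention: `L` is the linearisation of `+Q`, hence **non-positive**
  (`⟪g, L g⟫_M = -¼ ∫∫∫ B M M_* (g' + g_*' - g - g_*)² ≤ 0`); the spectral gap is stated for `-L`.
* `dirichletFormInv L A := ⨆ g, (2⟪A, g⟫_M + ⟪g, L g⟫_M)` is a real `iSup`; when `A` is not
  `M`-orthogonal to `ker L` the family is unbounded above and the value is the junk value `0`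
  (`Real.sSup` convention). Statements using it assume orthogonality, and
  `bddAbove_range_dirichlet_of_orthogonal` records that the supremum is then meaningful.
* `2 ≤ finrank ℝ E` is assumed where the classification of collision invariants is used (in
  dimension one the hard-sphere collision swaps velocities and `L = 0`).
-/

open MeasureTheory Metric Real ProbabilityTheory Module
open scoped InnerProductSpace

namespace Literature.Analysis.UnboundedOperators

noncomputable section

/-! ### Functions of temperate growth as a submodule -/

section TemperateGrowth

variable (E : Type*) [NormedAddCommGroup E] [NormedSpace ℝ E]

/-- The submodule of real functions of *temperate growth* on a real normed space `E`: smooth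
functions all of whose derivatives are polynomially bounded (Mathlib's
`Function.HasTemperateGrowth`; Hörmander, *The Analysis of Linear PDOs I*, §7.1). It contains the
polynomials and is the common domain of the linearised Boltzmann identities below
(CIP 1994 §7.1). [cite: CIP1994, §7.1] -/
def temperateGrowth : Submodule ℝ (E → ℝ) where
  carrier := {f | Function.HasTemperateGrowth f}
  add_mem' hf hg := hf.add hg
  zero_mem' := Function.HasTemperateGrowth.zero
  smul_mem' c _ hf := (Function.HasTemperateGrowth.const c).smul hf

variable {E}

/-- Membership in `temperateGrowth E` is `Function.HasTemperateGrowth`. [folklore] -/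
@[simp]
theorem mem_temperateGrowth_iff {f : E → ℝ} :
    f ∈ temperateGrowth E ↔ Function.HasTemperateGrowth f :=
  Iff.rfl

end TemperateGrowth

variable {E : Type*} [NormedAddCommGroup E] [InnerProductSpace ℝ E]

/-! ### Collision invariants -/

section Invariants

variable (E) in
/-- The space of (smooth) *collision invariants* `span {1, v ↦ ⟪v, e⟫ (e ∈ E), v ↦ |v|²}`, i.e.
the functions `v ↦ a + ⟪b, v⟫ + c |v|²`; in dimension `d` it has dimension `d + 2`
(CIP 1994 §3.1, Thm 3.1.1 and §7.1). [cite: CIP1994, §3.1  Thm 3.1.1 and §7.1] -/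
def collisionInvariants : Submodule ℝ (E → ℝ) :=
  Submodule.span ℝ
    ({fun _ => (1 : ℝ), fun v => ‖v‖ ^ 2} ∪ Set.range fun (e : E) (v : E) => ⟪v, e⟫_ℝ)

/-- A function is in `collisionInvariants E` iff it is of the form `v ↦ a + ⟪b, v⟫ + c |v|²`
(CIP 1994 §3.1). [cite: CIP1994, §3.1] -/
theorem mem_collisionInvariants_iff {φ : E → ℝ} :
    φ ∈ collisionInvariants E ↔
      ∃ (a c : ℝ) (b : E), φ = fun v => a + ⟪b, v⟫_ℝ + c * ‖v‖ ^ 2 := by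
  have h1 : (fun _ : E => (1 : ℝ)) ∈ collisionInvariants E :=
    Submodule.subset_span (Or.inl (Or.inl rfl))
  have h2 : (fun v : E => ‖v‖ ^ 2) ∈ collisionInvariants E :=
    Submodule.subset_span (Or.inl (Or.inr rfl))
  have h3 : ∀ e : E, (fun v : E => ⟪e, v⟫_ℝ) ∈ collisionInvariants E := fun e => by
    have : (fun v : E => ⟪e, v⟫_ℝ) = fun v => ⟪v, e⟫_ℝ := funext fun v => real_inner_comm _ _
    rw [this]
    exact Submodule.subset_span (Or.inr ⟨e, rfl⟩)
  constructor
  · intro hφ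
    induction hφ using Submodule.span_induction with
    | mem x hx =>
      simp only [Set.mem_union, Set.mem_insert_iff, Set.mem_singleton_iff, Set.mem_range] at hx
      rcases hx with (rfl | rfl) | ⟨e, rfl⟩
      · exact ⟨1, 0, 0, by funext v; simp⟩
      · exact ⟨0, 1, 0, by funext v; simp⟩
      · exact ⟨0, 0, e, by funext v; simp [real_inner_comm]⟩
    | zero => exact ⟨0, 0, 0, by funext v; simp⟩
    | add x y _ _ hx hy =>
      obtain ⟨a, c, b, rfl⟩ := hx
      obtain ⟨a', c', b', rfl⟩ := hy
      exact ⟨a + a', c + c', b + b', by funext v; simp only [Pi.add_apply, inner_add_left]; ring⟩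
    | smul r x _ hx =>
      obtain ⟨a, c, b, rfl⟩ := hx
      exact ⟨r * a, r * c, r • b, by
        funext v; simp only [Pi.smul_apply, smul_eq_mul, real_inner_smul_left]; ring⟩
  · rintro ⟨a, c, b, rfl⟩
    have : (fun v => a + ⟪b, v⟫_ℝ + c * ‖v‖ ^ 2) =
        a • (fun _ : E => (1 : ℝ)) + (fun v : E => ⟪b, v⟫_ℝ) + c • fun v : E => ‖v‖ ^ 2 := by
      funext v; simp
    rw [this]
    exact add_mem (add_mem (Submodule.smul_mem _ a h1) (h3 b)) (Submodule.smul_mem _ c h2)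

/-- Collision invariants have temperate growth (they are polynomials of degree `≤ 2`). [folklore] -/
theorem collisionInvariants_le_temperateGrowth : collisionInvariants E ≤ temperateGrowth E := by
  refine Submodule.span_le.2 ?_
  intro φ hφ
  simp only [Set.mem_union, Set.mem_insert_iff, Set.mem_singleton_iff, Set.mem_range] at hφ
  rcases hφ with (rfl | rfl) | ⟨e, rfl⟩
  · exact Function.HasTemperateGrowth.const (1 : ℝ)
  · exact Function.hasTemperateGrowth_norm_sq E
  · exact Function.hasTemperateGrowth_inner_left e

/-- Sanity link to Wave0: every element of `collisionInvariants E` is a collision invariant in the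
sense of `Hilbert6.IsCollisionInvariant`, i.e. `φ(v') + φ(v_*') = φ(v) + φ(v_*)`
(CIP 1994 §3.1). [cite: CIP1994, §3.1] -/
theorem isCollisionInvariant_of_mem_collisionInvariants {φ : E → ℝ}
    (hφ : φ ∈ collisionInvariants E) : Literature.MathematicalPhysics.KineticTheory.IsCollisionInvariant φ := by
  induction hφ using Submodule.span_induction with
  | mem x hx =>
    simp only [Set.mem_union, Set.mem_insert_iff, Set.mem_singleton_iff, Set.mem_range] at hx
    rcases hx with (rfl | rfl) | ⟨e, rfl⟩
    · simpa using Literature.MathematicalPhysics.KineticTheory.isCollisionInvariant_quadratic (E := E) 1 0 0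
    · simpa using Literature.MathematicalPhysics.KineticTheory.isCollisionInvariant_quadratic (E := E) 0 1 0
    · simpa [real_inner_comm] using Literature.MathematicalPhysics.KineticTheory.isCollisionInvariant_quadratic (E := E) 0 0 e
  | zero => intro ω p; simp
  | add x y _ _ hx hy =>
    intro ω p
    have h1 := hx ω p
    have h2 := hy ω p
    simp only [Pi.add_apply]
    linarith
  | smul a x _ hx =>
    intro ω p
    simp only [Pi.smul_apply, smul_eq_mul, ← mul_add, hx ω p]

end Invariants

/-! ### The linearised collision operator -/

variable [FiniteDimensional ℝ E] [MeasurableSpace E] [BorelSpace E]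

/-- The *linearised collision operator* with collision kernel `B`, around the normalised
Maxwellian `M` (`M dv = stdGaussian E`):
`L_B g (v) = ∫_E ∫_{S^{d-1}} B(v, v_*, ω) (g(v') + g(v_*') - g(v) - g(v_*)) dω M(v_*) dv_*`,
where `(v', v_*') = Hilbert6.collide ω (v, v_*)`. This is `M⁻¹ (Q_B(M, M g) + Q_B(M g, M))`
for the bilinear operator `Q_B` (CIP 1994 §7.1 (7.1.4)–(7.1.6); Ellis–Pinsky 1975 §1). Bochner
integrals: junk value `0` where not integrable. [cite: CIP1994, §7.1 (7.1.4] -/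
def linearizedCollisionOp (B : E × E → sphere (0 : E) 1 → ℝ) (g : E → ℝ) : E → ℝ := fun v =>
  ∫ w, ∫ ω, B (v, w) ω * (g (Literature.MathematicalPhysics.KineticTheory.collide ω (v, w)).1 + g (Literature.MathematicalPhysics.KineticTheory.collide ω (v, w)).2
    - g v - g w) ∂Literature.MathematicalPhysics.KineticTheory.sphereMeasure ∂(stdGaussian E)

/-- The *linearised hard-sphere collision operator*
`L g (v) = ∫_E ∫_{S^{d-1}} ((v - v_*)·ω)_+ (g' + g_*' - g - g_*) dω M(v_*) dv_*`, the
linearisation `g ↦ M⁻¹ (Q(M, M g) + Q(M g, M))` of Wave0's `Hilbert6.collisionOp` at the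
Maxwellian. It is symmetric and **non-positive** on `L²(M dv)` (CIP 1994 §7.1–7.2). [cite: CIP1994, §7.1–7.2] -/
def hardSphereLinearizedOp (g : E → ℝ) : E → ℝ :=
  linearizedCollisionOp Literature.MathematicalPhysics.KineticTheory.hardSphereKernel g

/-- The `L²(M dv)` pairing at function level: `⟪g, h⟫_M = ∫ g(v) h(v) M(v) dv`
(`M dv = stdGaussian E`; CIP 1994 §7.1). Junk value `0` when `g h ∉ L¹(M)`. [cite: CIP1994, §7.1] -/
def maxwellianInner (g h : E → ℝ) : ℝ :=
  ∫ v, g v * h v ∂(stdGaussian E)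

/-- A collision invariant (in the pointwise sense of Wave0) is annihilated by every linearised
collision operator: the integrand vanishes identically (CIP 1994 §7.1). [cite: CIP1994, §7.1] -/
theorem linearizedCollisionOp_eq_zero_of_isCollisionInvariant (B : E × E → sphere (0 : E) 1 → ℝ)
    {φ : E → ℝ} (hφ : Literature.MathematicalPhysics.KineticTheory.IsCollisionInvariant φ) : linearizedCollisionOp B φ = 0 := by
  funext v
  have h : ∀ (w : E) (ω : sphere (0 : E) 1),
      B (v, w) ω * (φ (Literature.MathematicalPhysics.KineticTheory.collide ω (v, w)).1 + φ (Literature.MathematicalPhysics.KineticTheory.collide ω (v, w)).2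
        - φ v - φ w) = 0 := fun w ω => by
    rw [hφ ω (v, w)]; ring
  simp [linearizedCollisionOp, h]

/-- Symmetry of the linearised collision operator on functions of temperate growth
(CIP 1994 §7.1, (7.1.9); Ellis–Pinsky 1975 §1): if the kernel `B` is measurable, polynomially
bounded in the velocities (uniformly on the sphere), and invariant under the measure-preserving
changes of variables `(v, v_*, ω) ↦ (v', v_*', -ω)` and `(v, v_*, ω) ↦ (v_*, v, -ω)` (both hold
for `Hilbert6.hardSphereKernel = ((v - v_*)·ω)_+` and for every kernel of the form
`b(|v - v_*|, |(v - v_*)·ω|)`), then `⟪h, L_B g⟫_M = ⟪L_B h, g⟫_M`. (The Maxwellian weight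
`M ⊗ M` is invariant under both maps by conservation of energy.) [cite: CIP1994, §7.1  (7.1.9] -/
def maxwellianInner_linearizedCollisionOp_comm : Prop :=
  ∀ {B : E × E → sphere (0 : E) 1 → ℝ} (hBm : Measurable (Function.uncurry B)) (hB : ∃ (k : ℕ) (C : ℝ), ∀ p ω, |B p ω| ≤ C * (1 + ‖p‖) ^ k) (hcoll : ∀ ω p, B (Literature.MathematicalPhysics.KineticTheory.collide ω p) (-ω) = B p ω) (hswap : ∀ ω p, B p.swap (-ω) = B p ω) {g h : E → ℝ} (hg : g ∈ temperateGrowth E) (hh : h ∈ temperateGrowth E),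
    maxwellianInner h (linearizedCollisionOp B g) =
      maxwellianInner (linearizedCollisionOp B h) g

omit [FiniteDimensional ℝ E] [MeasurableSpace E] [BorelSpace E] in
/-- The hard-sphere kernel is invariant under `(v, v_*, ω) ↦ (v', v_*', -ω)` (hypothesis `hcoll`
of `maxwellianInner_linearizedCollisionOp_comm`; CIP 1994 §3.1). [cite: CIP1994, §3.1] -/
theorem hardSphereKernel_collide_neg (ω : sphere (0 : E) 1) (p : E × E) :
    Literature.MathematicalPhysics.KineticTheory.hardSphereKernel (Literature.MathematicalPhysics.KineticTheory.collide ω p) (-ω) = Literature.MathematicalPhysics.KineticTheory.hardSphereKernel p ω := by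
  have h := Literature.MathematicalPhysics.KineticTheory.real_inner_self_sphere ω
  simp only [Literature.MathematicalPhysics.KineticTheory.hardSphereKernel, Literature.MathematicalPhysics.KineticTheory.collide, coe_neg_sphere, inner_neg_right,
    inner_sub_left, inner_add_left, inner_smul_left, h, RCLike.conj_to_real]
  congr 1
  ring

omit [FiniteDimensional ℝ E] [MeasurableSpace E] [BorelSpace E] in
/-- The hard-sphere kernel is invariant under `(v, v_*, ω) ↦ (v_*, v, -ω)` (hypothesis `hswap`
of `maxwellianInner_linearizedCollisionOp_comm`; CIP 1994 §3.1). [cite: CIP1994, §3.1] -/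
theorem hardSphereKernel_swap_neg (ω : sphere (0 : E) 1) (p : E × E) :
    Literature.MathematicalPhysics.KineticTheory.hardSphereKernel p.swap (-ω) = Literature.MathematicalPhysics.KineticTheory.hardSphereKernel p ω := by
  simp only [Literature.MathematicalPhysics.KineticTheory.hardSphereKernel, Prod.fst_swap, Prod.snd_swap, coe_neg_sphere,
    inner_neg_right, ← inner_neg_left, neg_sub]

/-- Non-positivity of the linearised hard-sphere operator (CIP 1994 §7.1 (7.1.10);
Ellis–Pinsky 1975 §1): for `g` of temperate growth,
`⟪g, L g⟫_M = -¼ ∫∫∫ ((v - v_*)·ω)_+ M M_* (g' + g_*' - g - g_*)² ≤ 0`. [cite: CIP1994, §7.1 (7.1.10] -/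
def maxwellianInner_hardSphereLinearizedOp_self_nonpos : Prop :=
  ∀ {g : E → ℝ} (hg : g ∈ temperateGrowth E),
    maxwellianInner g (hardSphereLinearizedOp g) ≤ 0

/-- The kernel of the linearised hard-sphere operator on functions of temperate growth is exactly
the space of collision invariants `span {1, vᵢ, |v|²}`, in velocity dimension `d ≥ 2`
(CIP 1994 §7.1 with Thm 3.1.1; Ellis–Pinsky 1975 Prop. 1.1). [cite: CIP1994, §7.1 with Thm 3.1.1] -/
def hardSphereLinearizedOp_eq_zero_iff : Prop :=
  ∀ (hE : 2 ≤ finrank ℝ E) {g : E → ℝ} (hg : g ∈ temperateGrowth E),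
    hardSphereLinearizedOp g = 0 ↔ g ∈ collisionInvariants E

/-- **Spectral gap** of the linearised hard-sphere operator (Baranger–Mouhot, Rev. Mat.
Iberoam. 21 (2005), Thm 1.1, with explicit `λ`; qualitatively Grad 1963, Ellis–Pinsky 1975
Prop. 1.1): in velocity dimension `d ≥ 2` there is `λ > 0` such that
`λ ‖g‖²_M ≤ -⟪g, L g⟫_M` for every `g` of temperate growth that is `M`-orthogonal to the collision
invariants. [cite: Grad1963, Ellis–Pinsky 1975 Prop. 1.1] -/
def le_neg_maxwellianInner_hardSphereLinearizedOp_of_orthogonal : Prop :=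
  ∀ (hE : 2 ≤ finrank ℝ E),
    ∃ lam : ℝ, 0 < lam ∧ ∀ g ∈ temperateGrowth E,
      (∀ φ ∈ collisionInvariants E, maxwellianInner g φ = 0) →
        lam * maxwellianInner g g ≤ -maxwellianInner g (hardSphereLinearizedOp g)

/-! ### The Dirichlet form of the pseudo-inverse -/

/-- The quadratic form of the pseudo-inverse of `-L`, variationally:
`dirichletFormInv L A = sup_{g of temperate growth} (2⟪A, g⟫_M + ⟪g, L g⟫_M)`.
When `-L` is non-negative and symmetric and `A` is `M`-orthogonal to `ker L`, this equals
`⟪A, (-L)⁻¹ A⟩_M = -⟪A, g_A⟫_M` for any solution `g_A` of `L g_A = A` (complete the square), which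
is how the Chapman–Enskog transport coefficients are expressed (CIP 1994 §7.2; Bardos–Golse–
Levermore 1993 §2). **Junk value:** if `A` is not orthogonal to `ker L` (or `-L` is not
non-negative) the family is unbounded above and the real `iSup` is `0` by the `Real.sSup`
convention. [cite: CIP1994, §7.2] -/
def dirichletFormInv (L : (E → ℝ) → E → ℝ) (A : E → ℝ) : ℝ :=
  ⨆ g : temperateGrowth E, (2 * maxwellianInner A (g : E → ℝ) + maxwellianInner (g : E → ℝ) (L g))

/-- For `A` of temperate growth and `M`-orthogonal to the collision invariants, the variational
family defining `dirichletFormInv hardSphereLinearizedOp A` is bounded above (by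
`λ⁻¹ ‖A‖²_M`, from the spectral gap), so that the supremum is meaningful (CIP 1994 §7.2;
Baranger–Mouhot 2005 Thm 1.1). [cite: CIP1994, §7.2] -/
def bddAbove_range_dirichlet_of_orthogonal : Prop :=
  ∀ (hE : 2 ≤ finrank ℝ E) {A : E → ℝ} (hA : A ∈ temperateGrowth E) (horth : ∀ φ ∈ collisionInvariants E, maxwellianInner A φ = 0),
    BddAbove (Set.range fun g : temperateGrowth E =>
      2 * maxwellianInner A (g : E → ℝ) +
        maxwellianInner (g : E → ℝ) (hardSphereLinearizedOp (g : E → ℝ)))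

/-- `⟪A, (-L)⁻¹ A⟩_M ≥ 0` for `A` of temperate growth orthogonal to the collision invariants
(take `g = 0` in the variational family; CIP 1994 §7.2). [cite: CIP1994, §7.2] -/
def dirichletFormInv_nonneg_of_orthogonal : Prop :=
  ∀ (hE : 2 ≤ finrank ℝ E) {A : E → ℝ} (hA : A ∈ temperateGrowth E) (horth : ∀ φ ∈ collisionInvariants E, maxwellianInner A φ = 0),
    0 ≤ dirichletFormInv hardSphereLinearizedOp A

/- interim proof relied on results that are now named facts (D-0014); demoted to a fact by the M5 import, proof preserved:
:= by
  refine le_ciSup_of_le (bddAbove_range_dirichlet_of_orthogonal hE hA horth) 0 (le_of_eq ?_)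
  simp [maxwellianInner]
-/

/-- `⟪A, (-L)⁻¹ A⟩_M > 0` for a *non-zero* `A` of temperate growth orthogonal to the collision
invariants (take `g = ε A` with `ε` small; CIP 1994 §7.2). In particular the Chapman–Enskog
viscosity and heat conductivity are strictly positive. [cite: CIP1994, §7.2] -/
def dirichletFormInv_pos_of_orthogonal_of_ne_zero : Prop :=
  ∀ (hE : 2 ≤ finrank ℝ E) {A : E → ℝ} (hA : A ∈ temperateGrowth E) (horth : ∀ φ ∈ collisionInvariants E, maxwellianInner A φ = 0) (hA0 : A ≠ 0),
    0 < dirichletFormInv hardSphereLinearizedOp A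

/-! ### Self-adjoint realisation on `L²(M dv)` -/

/-- **Self-adjoint realisation** (CIP 1994 §7.2, Thm 7.2.1 ff.; Ellis–Pinsky 1975 §1; Grad 1963):
in velocity dimension `d ≥ 2` there is a self-adjoint, non-positive, partially defined operator
`A` on `L²(M dv) = Lp ℝ 2 (stdGaussian E)` having the classes of temperate-growth functions as a
core (`LinearPMap.HasCore`) and acting on them as the linearised hard-sphere operator
`hardSphereLinearizedOp`. (Its domain is `{g | (1 + |v|)^{1/2}… g ∈ L²(M)}`, the form domain of the
collision frequency; only the core property is recorded.) [cite: CIP1994, §7.2  Thm 7.2.1 ff] -/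
def exists_isSelfAdjoint_hasCore : Prop :=
  ∀ (hE : 2 ≤ finrank ℝ E),
    ∃ (S : Submodule ℝ (Lp ℝ 2 (stdGaussian E)))
      (A : Lp ℝ 2 (stdGaussian E) →ₗ.[ℝ] Lp ℝ 2 (stdGaussian E)),
      IsSelfAdjoint A ∧ (-A).IsPositive ∧ A.HasCore S ∧
      (∀ f : Lp ℝ 2 (stdGaussian E),
        f ∈ S ↔ ∃ g ∈ temperateGrowth E, (f : E → ℝ) =ᵐ[stdGaussian E] g) ∧
      ∀ (f : A.domain) (g : E → ℝ), g ∈ temperateGrowth E →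
        ((f : Lp ℝ 2 (stdGaussian E)) : E → ℝ) =ᵐ[stdGaussian E] g →
        ((A f : Lp ℝ 2 (stdGaussian E)) : E → ℝ) =ᵐ[stdGaussian E] hardSphereLinearizedOp g

/-! ### Burnett functions and the Chapman–Enskog Dirichlet sums -/

section Burnett

variable {ι : Type*} [Fintype ι] [DecidableEq ι]

/-- The (kinetic momentum flux) *Burnett function* `A_{ij}(v) = vᵢ vⱼ - δ_{ij} |v|² / d`, the
traceless part of `v ⊗ v`, in the coordinates of an orthonormal basis `b`
(Bardos–Golse–Levermore, CPAM 46 (1993) §2; CIP 1994 §7.2; Golse–Saint-Raymond, Invent. Math. 155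
(2004) (1.13)). It is `M`-orthogonal to the collision invariants. [cite: CIP1994, §7.2] -/
def burnettA (b : OrthonormalBasis ι ℝ E) (i j : ι) : E → ℝ := fun v =>
  b.repr v i * b.repr v j - if i = j then ‖v‖ ^ 2 / finrank ℝ E else 0

/-- The (heat flux) *Burnett function* `B_i(v) = ½ vᵢ (|v|² - (d + 2))` in the coordinates of an
orthonormal basis `b` (Bardos–Golse–Levermore 1993 §2; CIP 1994 §7.2; Golse–Saint-Raymond 2004
(1.13)). It is `M`-orthogonal to the collision invariants. [cite: BardosGolseLevermore1993, §2] -/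
def burnettB (b : OrthonormalBasis ι ℝ E) (i : ι) : E → ℝ := fun v =>
  b.repr v i * (‖v‖ ^ 2 - (finrank ℝ E + 2)) / 2

omit [FiniteDimensional ℝ E] [MeasurableSpace E] [BorelSpace E] in
/-- The Burnett function `A_{ij}` has temperate growth (it is a quadratic polynomial). [folklore] -/
theorem burnettA_mem_temperateGrowth (b : OrthonormalBasis ι ℝ E) (i j : ι) :
    burnettA b i j ∈ temperateGrowth E := by
  have hi : ∀ k : ι, Function.HasTemperateGrowth fun v : E => b.repr v k := fun k => by
    simpa [OrthonormalBasis.repr_apply_apply] using Function.hasTemperateGrowth_inner_right (b k)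
  change Function.HasTemperateGrowth _
  unfold burnettA
  split_ifs
  · exact ((hi i).mul (hi j)).sub
      ((Function.hasTemperateGrowth_norm_sq E).mul (.const ((finrank ℝ E : ℝ)⁻¹)))
  · exact ((hi i).mul (hi j)).sub (.const 0)

omit [FiniteDimensional ℝ E] [MeasurableSpace E] [BorelSpace E] [DecidableEq ι] in
/-- The Burnett function `B_i` has temperate growth (it is a cubic polynomial). [folklore] -/
theorem burnettB_mem_temperateGrowth (b : OrthonormalBasis ι ℝ E) (i : ι) :
    burnettB b i ∈ temperateGrowth E := by
  have hi : Function.HasTemperateGrowth fun v : E => b.repr v i := by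
    simpa [OrthonormalBasis.repr_apply_apply] using Function.hasTemperateGrowth_inner_right (b i)
  change Function.HasTemperateGrowth _
  unfold burnettB
  exact ((hi.mul ((Function.hasTemperateGrowth_norm_sq E).sub (.const _))).mul (.const (2 : ℝ)⁻¹))

/-- `A_{ij} ⊥_M` collision invariants: `∫ A_{ij} φ dM = 0` for `φ ∈ span {1, vₖ, |v|²}`
(Gaussian moments; Bardos–Golse–Levermore 1993 §2, CIP 1994 §7.2). [cite: BardosGolseLevermore1993, §2  CIP 1994 §7.2] -/
def burnettA_orthogonal_collisionInvariants : Prop :=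
  ∀ (b : OrthonormalBasis ι ℝ E) (i j : ι) {φ : E → ℝ} (hφ : φ ∈ collisionInvariants E),
    maxwellianInner (burnettA b i j) φ = 0

/-- `B_i ⊥_M` collision invariants: `∫ B_i φ dM = 0` for `φ ∈ span {1, vₖ, |v|²}` (Gaussian
moments `∫ vᵢ² |v|² dM = d + 2`; Bardos–Golse–Levermore 1993 §2, CIP 1994 §7.2). [cite: BardosGolseLevermore1993, §2  CIP 1994 §7.2] -/
def burnettB_orthogonal_collisionInvariants : Prop :=
  ∀ (b : OrthonormalBasis ι ℝ E) (i : ι) {φ : E → ℝ} (hφ : φ ∈ collisionInvariants E),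
    maxwellianInner (burnettB b i) φ = 0

/-- The *viscosity Dirichlet sum* `∑_{i,j} ⟪A_{ij}, (-L)⁻¹ A_{ij}⟩_M` of a linearised collision
operator `L`; up to a dimensional constant `1/((d-1)(d+2))` (kept in the statement file) this is
the Chapman–Enskog / incompressible-Navier–Stokes-limit viscosity
(Bardos–Golse–Levermore 1993 §2; Golse–Saint-Raymond 2004 (1.15); CIP 1994 §7.2). [cite: BardosGolseLevermore1993, §2] -/
def viscosityDirichletSum (L : (E → ℝ) → E → ℝ) (b : OrthonormalBasis ι ℝ E) : ℝ :=
  ∑ i, ∑ j, dirichletFormInv L (burnettA b i j)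

/-- The *heat-conductivity Dirichlet sum* `∑_i ⟪B_i, (-L)⁻¹ B_i⟩_M` of a linearised collision
operator `L`; up to a dimensional constant `2/(d(d+2))` (kept in the statement file) this is the
Chapman–Enskog / Fourier-limit heat conductivity (Bardos–Golse–Levermore 1993 §2;
Golse–Saint-Raymond 2004 (1.16); CIP 1994 §7.2). [cite: BardosGolseLevermore1993, §2] -/
def conductivityDirichletSum (L : (E → ℝ) → E → ℝ) (b : OrthonormalBasis ι ℝ E) : ℝ :=
  ∑ i, dirichletFormInv L (burnettB b i)

variable {ι' : Type*} [Fintype ι'] [DecidableEq ι']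

/-- The viscosity Dirichlet sum of the linearised hard-sphere operator does not depend on the
orthonormal basis: `A_{ij}` transforms tensorially and `⟪·, (-L)⁻¹ ·⟩_M` is a bilinear form on the
orthogonal complement of the collision invariants (velocity dimension `d ≥ 2`; CIP 1994 §7.2). [cite: CIP1994, §7.2] -/
def viscosityDirichletSum_indep : Prop :=
  ∀ (hE : 2 ≤ finrank ℝ E) (b : OrthonormalBasis ι ℝ E) (b' : OrthonormalBasis ι' ℝ E),
    viscosityDirichletSum hardSphereLinearizedOp b =
      viscosityDirichletSum hardSphereLinearizedOp b'

/-- The heat-conductivity Dirichlet sum of the linearised hard-sphere operator does not depend on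
the orthonormal basis (`B_i` transforms vectorially; velocity dimension `d ≥ 2`; CIP 1994 §7.2). [cite: CIP1994, §7.2] -/
def conductivityDirichletSum_indep : Prop :=
  ∀ (hE : 2 ≤ finrank ℝ E) (b : OrthonormalBasis ι ℝ E) (b' : OrthonormalBasis ι' ℝ E),
    conductivityDirichletSum hardSphereLinearizedOp b =
      conductivityDirichletSum hardSphereLinearizedOp b'

end Burnett

end

end Literature.Analysis.UnboundedOperators
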